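import Literature.NumberTheory.Rogawski1990.ArchInnerFormChartOrbDescent   -- ★ p850324∕p850344 (F0P3a-p08 (g22)) (J-DESC) D4b: `chartOrbG_eq_integral_descended_of_cutoff` (+ ★ (T-MEAS-G′), ★ D2∕D3)
import Literature.NumberTheory.Rogawski1990.ArchHCSpaceG                 -- ★ p849664∕p849799 (LH3-p02 (g2)): `hcNrm` (the wall normal of organ J)
import HarnessLib

/-!
# (J-G′-BLOCK): the chart orbital functional `chartOrbG` along the wall normal IS `K · Φ(ν)`, `Φ` a block orbital integral — the (DESC) binder of the (J-G′-JUMP) shell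
# (Rogawski 1990 §4.12 Lemma 4.12.1, §8.2 pp. 119–124; Harish-Chandra–van Dijk 1970 Part I §3; Folland 1995 §2.6 (2.52))

Topic `NumberTheory/Rogawski1990`; namespace `Literature.NumberTheory.Rogawski1990`.  THEOREMS ONLY (no `def`, no instance, no notation, no axiom, no named fact, no `sorry`);
kernel lane `--kind proof --supports stmt-HodgeConjecture-24833`.  Cell `pub/hodgecm-mathlib`, crux H413 (`stmt-HodgeConjecture-24833`), F0∕P3c line LH3 (closer stub `stub_N9`,
DIRECT ROAD `F0_P3c_StubN9Direct`, organ J `JumpAgreementStatement`): brick **(J-G′-JUMP) piece (b) = (J-G′-BLOCK)** (LH3-plan (g3) RULINGS #6 (a), 2026-09-02T07:51Z, seat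
F0P3-p02 (g18)): the hypothesis `hdesc : ∀ᶠ ν in 𝓝[≠] 0, chartOrbG L α ν′ S a′ (p + ν • hcNrm w 0 2) = K * Φ ν` of the ★ shell `ArchOrbFamGExtJumpOfBricks` (p850303, LH3-p02 (g2)),
discharged IN BINDER FORM over ★ (J-DESC) D4b `chartOrbG_eq_integral_descended_of_cutoff` (F0P3a-p08 (g22)) and an ABSTRACT block equivalence `eM : Z(s) ≃ₜ* B × R` carrying the
(M-UNFOLD) data as hypotheses (F0P3a-p04 (g22) census (u1): no new measure theory — ★ `InvariantQuotientProd` ∕ ★ `InvariantQuotientPiTopFactor{,Map}` ∕ ★ `InvariantQuotientCompactSubgroup`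
discharge them in (M-UNFOLD) (u2)).

THE MATHEMATICS.  Fix the wall point `s ∈ G′_∞` of organ J (`s = gprimeTorus α S p`, `p` semiregular on the compact wall `(w, 0, 2)`, `w ∉ S`) and `M′ := Z_{G′_∞}(s)`, `T′ := T_S ∩ M′`
(`T_S = chartTorusG ≤ M′`).  ★ D4b says: along any family of chart points whose conjugates stay in ONE compact modulo `M′` (★ D4b-1) and whose chart integrand is integrable,
`chartOrbG L α ν′ S a′ c = dt′(B′) · ∫_{M′ ⧸ T′} (a′)_M(k · gprimeTorus c · k⁻¹) d(νM ∕ νT′)` with ONE descended `(a′)_M(m) = ∫ β(x) • a′(x m x⁻¹) dν′` (the SAME `β` for every chart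
through `s` — LH3-p02 (g2)'s cross-chart consistency).  (M-UNFOLD): `M′ ≅ U(1,1)_w × (U(1)_w × Π_{v≠w} T_v) =: B × R` (`eM`), `T′ ↦ A × R` (`A` the compact diagonal torus of the block),
so `M′ ⧸ T′ ≃ₜ B ⧸ A` (`Ψ`, `Ψ⁻¹(b A) = eM⁻¹(b, 1) T′`) and `Ψ_*(νM ∕ νT′) = κ • π_* νB` (`A` compact: ★ `quotientMeasure_eq_inv_smul_map_mk`); along the normal `c_ν = p + ν • hcNrm w 0 2`
only the `(0,2)`-angles at `w` move, i.e. `eM(gprimeTorus c_ν) = (γ_B(ν), r₀)` with `r₀ ∈ R` FIXED (`γ_B(ν) = z·diag(e^{iν}, e^{−iν})` in the block).  THEN, since the `R`-component of a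
conjugating `eM⁻¹(b, 1)` is trivial, `(a′)_M(k · gprimeTorus c_ν · k⁻¹)` at `k = eM⁻¹(b, 1)` is `f_B(b γ_B(ν) b⁻¹)` with **`f_B(b) := (a′)_M(eM⁻¹(b, r₀))`** ∈ `C_c(B)`, and by change of
variables along `Ψ`:
  **`chartOrbG L α ν′ S a′ (p + ν • hcNrm w 0 2) = (dt′(B′) · κ) · ∫_B f_B(b · γ_B(ν) · b⁻¹) dνB(b)`  for all small `ν ≠ 0`**
— the ★ shell's `hdesc` with `K := dt′(B′)·κ`, `Φ(ν) := ∫_B f_B(b γ_B(ν) b⁻¹) dνB`, `Φ` in the WHOLE-GROUP currency of ★ (K0±-FORM-TRANSPORT)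
`exists_hasOneSidedJump_two_sin_mul_orbitalIntegral_group_of_eq_over` (p850353, F0P3a-p07 (g16)), whose `F := f_B` this file exports continuous and compactly supported.

* §1 (generic, group level — reusable by (G′-CAY)) `descConj_symm_mk_eq_of_block` (the integrand in the coordinates `Ψ`) and **`integral_descConj_eq_smul_integral_of_block`**:
  `∫_{G⧸T} (y ↦ F(y γ y⁻¹)) dμ = κ • ∫_B F(eM⁻¹(b γ_B b⁻¹, r)) dνB` for ANY measure `μ` on `G ⧸ T` with `Ψ_* μ = κ • π_* νB` and `eM γ = (γ_B, r)` — no Haar theory inside.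
* §2 (generic) `continuous_comp_symm_prodMk`, `hasCompactSupport_comp_symm_prodMk` — `b ↦ F(eM⁻¹(b, r))` is in `C_c(B)` when `F ∈ C_c(G)`.
* §3 (the LH3 dress) **`chartOrbG_add_smul_hcNrm_eventuallyEq_of_block`** (from any eventual descent identity `hdescent` — e.g. ★ D4b's — and the block data: the shell's `hdesc`
  with `K := C₀ · κ`); **`chartOrbG_add_smul_hcNrm_eventuallyEq_descended_of_cutoff`** (★ D4b ED. 2 along the normal under the EVENTUAL binders `hCMν` (★ D4b-1 on the normal
  segment) and `hintν` (integrability at the regular points `c_ν`, `ν ≠ 0`)); and the package **`exists_block_testFunction_chartOrbG_eventuallyEq`**: `∃ f_B ∈ C_c(B)` (continuous,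
  compactly supported, `= (a′)_M^β ∘ eM⁻¹(·, r₀)` on the nose) with the displayed identity — feed `f_B` to ★ p850353 for `hjump`, ★ `ArchOrbFamGExtJumpWall` for `hwall`∕`hR`.
NOT HERE (binders, by name): the construction of `eM ∕ Ψ ∕ hΨ ∕ hmap ∕ hγ` = (M-UNFOLD) (u2) (F0P3a-p08 (g22)); `hCMν` (★ D4b-1 `exists_isCompact_mul_gprimeTorus_of_semireg` on the
compact normal segment, modulo its `hsplit`); `hintν` (★ `integrable_descConj_gprimeTorus_empty_of_regG` for `S = ∅`; general admissible `S` open).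
HONEST LABEL: HC_CM is proved only modulo the 7 printed citations (2 remaining named inputs: hLiu418 = `stmt-HodgeConjecture-24832`, h413 = `stmt-HodgeConjecture-24833`) until rung 0
closes; count-neutral (measure-theoretic bookkeeping under organ J of `stub_N9`; no stub closes by this file alone).

## References
* [Rogawski1990] J. D. Rogawski, *Automorphic Representations of Unitary Groups in Three Variables*, Ann. of Math. Stud. 123 (1990), §4.12 Lemma 4.12.1 p. 66 (descent to `M`,
  ONE `φ` for all `x` near `1`), §8.2 pp. 114, 119–124 (`g(ψ) = 2 sin ψ · Φ`, the `U(1,1)`-block at a compact wall).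
* [HarishChandra1970] Harish-Chandra (notes by G. van Dijk), *Harmonic Analysis on Reductive p-adic Groups*, LNM 162 (1970), Part I §3 Lemmas 22–23.
* [Folland1995] G. B. Folland, *A Course in Abstract Harmonic Analysis* (1995), §2.6 Thm. 2.49, (2.52) (quotient measures of products, change of variables).
* [Shelstad1979] D. Shelstad, *Characters and inner forms of a quasi-split group over ℝ*, Compositio Math. 39 (1979), §4 pp. 22–25 (the rank-one reduction at a compact wall).
-/

set_option autoImplicit false

noncomputable section

open MeasureTheory MeasureTheory.Measure Set Filter Topology NumberField NumberField.InfinitePlace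
open Literature.MeasureTheory.Group Literature.NumberTheory.Automorphic Literature.NumberTheory.Automorphic.UnitaryGroup
open scoped MatrixGroups Matrix Pointwise NNReal Classical

namespace Literature.NumberTheory.Rogawski1990

/-! ## §1 Generic: the orbital integrand and its integral through a block equivalence `eM : G ≃ₜ* B × R` -/

section Block

variable {G B R : Type*} [Group G] [Group B] [Group R] [TopologicalSpace G] [TopologicalSpace B] [TopologicalSpace R]
  (T : Subgroup G) (A : Subgroup B) (eM : G ≃ₜ* B × R)

/-- **The orbital integrand in the block coordinates**: if `Ψ⁻¹(b A) = eM⁻¹(b, 1) T` and `eM γ = (γ_B, r)`, then `(y T ↦ F(y γ y⁻¹))(Ψ⁻¹(b A)) = F(eM⁻¹(b γ_B b⁻¹, r))` — the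
`R`-component of the conjugating element is `1`, so the `R`-coordinate of `γ` is untouched (no commutativity of `R` needed). [cite: Folland1995, §2.6 (2.52)]
[cite: Rogawski1990, §4.12 Lemma 4.12.1 p. 66] -/
theorem descConj_symm_mk_eq_of_block (Ψ : G ⧸ T ≃ₜ B ⧸ A) (hΨ : ∀ b : B, Ψ.symm (QuotientGroup.mk b) = QuotientGroup.mk (eM.symm (b, 1)))
    (γ : G) (γB : B) (r : R) (hγ : eM γ = (γB, r)) (hTγ : ∀ t ∈ T, t * γ = γ * t) {X : Type*} (F : G → X) (b : B) :
    descConj γ T hTγ F (Ψ.symm (QuotientGroup.mk b)) = F (eM.symm (b * γB * b⁻¹, r)) := by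
  rw [hΨ, descConj_mk]
  congr 1
  apply eM.injective
  rw [map_mul, map_mul, map_inv, hγ, ContinuousMulEquiv.apply_symm_apply, ContinuousMulEquiv.apply_symm_apply, Prod.inv_mk, inv_one, Prod.mk_mul_mk, Prod.mk_mul_mk,
    one_mul, mul_one]

variable [IsTopologicalGroup G] [MeasurableSpace (G ⧸ T)] [BorelSpace (G ⧸ T)]
  [MeasurableSpace B] [BorelSpace B] [MeasurableSpace (B ⧸ A)] [BorelSpace (B ⧸ A)]

/-- **BLOCK REDUCTION OF THE QUOTIENT ORBITAL INTEGRAL** (change of variables along `Ψ : G ⧸ T ≃ₜ B ⧸ A`, then un-quotienting on the block): for ANY measure `μ` on `G ⧸ T` with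
`Ψ_* μ = κ • π_* νB` (`π : B → B ⧸ A`; e.g. the invariant quotient measure of `Z(s)` by `T′` versus Haar on the `U(1,1)`-block with its COMPACT torus, ★ `quotientMeasure_eq_inv_smul_map_mk`),
`Ψ⁻¹(b A) = eM⁻¹(b, 1) T`, `eM γ = (γ_B, r)` and `F` continuous:
`∫_{G ⧸ T} F(y γ y⁻¹) dμ(ẏ) = κ • ∫_B F(eM⁻¹(b γ_B b⁻¹, r)) dνB(b)`. [cite: Folland1995, §2.6 Thm. 2.49, (2.52)] [cite: Rogawski1990, §4.12 Lemma 4.12.1 p. 66; §8.2 p. 122] -/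
theorem integral_descConj_eq_smul_integral_of_block (Ψ : G ⧸ T ≃ₜ B ⧸ A) (hΨ : ∀ b : B, Ψ.symm (QuotientGroup.mk b) = QuotientGroup.mk (eM.symm (b, 1)))
    (μ : Measure (G ⧸ T)) (νB : Measure B) {κ : ℝ≥0} (hmap : Measure.map Ψ μ = κ • Measure.map (QuotientGroup.mk : B → B ⧸ A) νB)
    (γ : G) (γB : B) (r : R) (hγ : eM γ = (γB, r)) (hTγ : ∀ t ∈ T, t * γ = γ * t)
    {E : Type*} [NormedAddCommGroup E] [NormedSpace ℝ E] [SecondCountableTopology E] {F : G → E} (hF : Continuous F) :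
    ∫ q, descConj γ T hTγ F q ∂μ = κ • ∫ b, F (eM.symm (b * γB * b⁻¹, r)) ∂νB := by
  -- change of variables along `Ψ`
  have h1 : ∫ q, descConj γ T hTγ F q ∂μ = ∫ q', descConj γ T hTγ F (Ψ.symm q') ∂(Measure.map Ψ μ) := by
    rw [← Homeomorph.toMeasurableEquiv_coe, integral_map_equiv]
    simp only [Homeomorph.toMeasurableEquiv_coe, Homeomorph.symm_apply_apply]
  rw [h1, hmap, integral_smul_nnreal_measure]
  congr 1
  -- un-quotient on the block
  have hc : Continuous fun q' : B ⧸ A => descConj γ T hTγ F (Ψ.symm q') := (continuous_descConj γ T hTγ hF).comp Ψ.symm.continuous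
  rw [integral_map QuotientGroup.continuous_mk.measurable.aemeasurable hc.aestronglyMeasurable]
  exact integral_congr_ae (Eventually.of_forall fun b => descConj_symm_mk_eq_of_block T A eM Ψ hΨ γ γB r hγ hTγ F b)

end Block

/-! ## §2 Generic: the block test function `b ↦ F(eM⁻¹(b, r))` is in `C_c(B)` -/

section BlockTest

variable {G B R : Type*} [Group G] [Group B] [Group R] [TopologicalSpace G] [TopologicalSpace B] [TopologicalSpace R] (eM : G ≃ₜ* B × R)

/-- `b ↦ F(eM⁻¹(b, r))` is continuous for `F` continuous (the block restriction of the descended test function, «`φ` is smooth»). [cite: Rogawski1990, §4.12 Lemma 4.12.1 p. 66] -/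
theorem continuous_comp_symm_prodMk {X : Type*} [TopologicalSpace X] {F : G → X} (hF : Continuous F) (r : R) :
    Continuous fun b : B => F (eM.symm (b, r)) :=
  hF.comp (eM.symm.continuous.comp (continuous_id.prodMk continuous_const))

/-- `b ↦ F(eM⁻¹(b, r))` is compactly supported for `F` compactly supported: its support lies in the first projection of `eM(tsupport F)` (the block restriction of the descended
test function, «`φ` has compact support»). [cite: Rogawski1990, §4.12 Lemma 4.12.1 p. 66] [cite: HarishChandra1970, Part I §3 Lemma 21] -/
theorem hasCompactSupport_comp_symm_prodMk [T2Space B] {X : Type*} [Zero X] {F : G → X} (hF : HasCompactSupport F) (r : R) :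
    HasCompactSupport fun b : B => F (eM.symm (b, r)) := by
  refine HasCompactSupport.intro ((hF.isCompact.image eM.continuous).image continuous_fst) fun b hb => ?_
  by_contra h
  exact hb ⟨(b, r), ⟨eM.symm (b, r), subset_tsupport _ (Function.mem_support.2 h), eM.apply_symm_apply _⟩, rfl⟩

end BlockTest

/-! ## §3 The LH3 dress: `chartOrbG` along the wall normal `p + ν • hcNrm w 0 2` -/

section Chart

variable (L : Type) [Field L] [NumberField L] [IsCMField L] (α : Fin 3 → L)
  [MeasurableSpace ↥(arch (↥(maximalRealSubfield L)) L (IsCMField.complexConj L) 3 (Matrix.diagonal α))]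
  [BorelSpace ↥(arch (↥(maximalRealSubfield L)) L (IsCMField.complexConj L) 3 (Matrix.diagonal α))]
  (ν' : Measure ↥(arch (↥(maximalRealSubfield L)) L (IsCMField.complexConj L) 3 (Matrix.diagonal α))) [ν'.IsHaarMeasure] [ν'.IsMulRightInvariant]
  (a' : ↥(arch (↥(maximalRealSubfield L)) L (IsCMField.complexConj L) 3 (Matrix.diagonal α)) → ℂ)
  (S : Finset {w : InfinitePlace L // IsComplex w}) (w : {w : InfinitePlace L // IsComplex w}) (p : {w : InfinitePlace L // IsComplex w} → Fin 3 → ℝ)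
  (s : ↥(arch (↥(maximalRealSubfield L)) L (IsCMField.complexConj L) 3 (Matrix.diagonal α)))
  (hT : chartTorusG L α S ≤ Subgroup.centralizer ({s} : Set ↥(arch (↥(maximalRealSubfield L)) L (IsCMField.complexConj L) 3 (Matrix.diagonal α))))
  [MeasurableSpace (↥(Subgroup.centralizer ({s} : Set ↥(arch (↥(maximalRealSubfield L)) L (IsCMField.complexConj L) 3 (Matrix.diagonal α)))) ⧸
    (chartTorusG L α S).subgroupOf (Subgroup.centralizer ({s} : Set ↥(arch (↥(maximalRealSubfield L)) L (IsCMField.complexConj L) 3 (Matrix.diagonal α)))))]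
  [BorelSpace (↥(Subgroup.centralizer ({s} : Set ↥(arch (↥(maximalRealSubfield L)) L (IsCMField.complexConj L) 3 (Matrix.diagonal α)))) ⧸
    (chartTorusG L α S).subgroupOf (Subgroup.centralizer ({s} : Set ↥(arch (↥(maximalRealSubfield L)) L (IsCMField.complexConj L) 3 (Matrix.diagonal α)))))]
  -- the block data ((M-UNFOLD) (u2) discharges these by name)
  {B R : Type*} [Group B] [TopologicalSpace B] [T2Space B] [MeasurableSpace B] [BorelSpace B] [Group R] [TopologicalSpace R]
  (A : Subgroup B) [MeasurableSpace (B ⧸ A)] [BorelSpace (B ⧸ A)]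
  (eM : ↥(Subgroup.centralizer ({s} : Set ↥(arch (↥(maximalRealSubfield L)) L (IsCMField.complexConj L) 3 (Matrix.diagonal α)))) ≃ₜ* B × R)
  (Ψ : (↥(Subgroup.centralizer ({s} : Set ↥(arch (↥(maximalRealSubfield L)) L (IsCMField.complexConj L) 3 (Matrix.diagonal α)))) ⧸
      (chartTorusG L α S).subgroupOf (Subgroup.centralizer ({s} : Set ↥(arch (↥(maximalRealSubfield L)) L (IsCMField.complexConj L) 3 (Matrix.diagonal α))))) ≃ₜ B ⧸ A)
  (hΨ : ∀ b : B, Ψ.symm (QuotientGroup.mk b) = QuotientGroup.mk (eM.symm (b, 1)))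
  (νB : Measure B) (γB : ℝ → B) (r₀ : R)
  (hγ : ∀ ν : ℝ, eM ⟨gprimeTorus L α S (p + ν • hcNrm w 0 2), hT (gprimeTorus_mem_chartTorusG L α S _)⟩ = (γB ν, r₀))

include hΨ hγ in
omit [T2Space B] in
/-- **(J-G′-BLOCK) FROM AN EVENTUAL DESCENT IDENTITY**: if along the normal, for small `ν ≠ 0`, `chartOrbG L α ν′ S a′ c_ν = C₀ · ∫_{Z(s) ⧸ T′} (a′)_M(k · gprimeTorus c_ν · k⁻¹) dμ`
(★ D4b at `μ = νM ∕ νT′`, `C₀ = dt′(B′)`), and the block data `(eM, Ψ, νB, κ, γ_B, r₀)` satisfy `Ψ⁻¹(bA) = eM⁻¹(b,1)T′`, `Ψ_* μ = κ • π_* νB`, `eM(gprimeTorus c_ν) = (γ_B(ν), r₀)`, then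
**`chartOrbG L α ν′ S a′ (p + ν • hcNrm w 0 2) = (C₀ · κ) · ∫_B (a′)_M(eM⁻¹(b γ_B(ν) b⁻¹, r₀)) dνB` for small `ν ≠ 0`** — the ★ shell's `hdesc` with `K := C₀ · κ`,
`Φ(ν) := ∫_B f_B(b γ_B(ν) b⁻¹) dνB`, `f_B := (a′)_M ∘ eM⁻¹(·, r₀)`. [cite: Rogawski1990, §4.12 Lemma 4.12.1 p. 66; §8.2 pp. 119–124] [cite: Folland1995, §2.6 (2.52)]
[cite: Shelstad1979, §4 pp. 22–25] -/
theorem chartOrbG_add_smul_hcNrm_eventuallyEq_of_block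
    (μ : Measure ((↥(Subgroup.centralizer ({s} : Set ↥(arch (↥(maximalRealSubfield L)) L (IsCMField.complexConj L) 3 (Matrix.diagonal α)))) ⧸
      (chartTorusG L α S).subgroupOf (Subgroup.centralizer ({s} : Set ↥(arch (↥(maximalRealSubfield L)) L (IsCMField.complexConj L) 3 (Matrix.diagonal α)))))))
    {κ : ℝ≥0} (hmap : Measure.map Ψ μ = κ • Measure.map (QuotientGroup.mk : B → B ⧸ A) νB)
    {aM : ↥(Subgroup.centralizer ({s} : Set ↥(arch (↥(maximalRealSubfield L)) L (IsCMField.complexConj L) 3 (Matrix.diagonal α)))) → ℂ} (haM : Continuous aM) {C₀ : ℂ}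
    (hdescent : ∀ᶠ ν in 𝓝[≠] (0 : ℝ), chartOrbG L α ν' S a' (p + ν • hcNrm w 0 2) =
      C₀ * ∫ kq, descConj
          (⟨gprimeTorus L α S (p + ν • hcNrm w 0 2), hT (gprimeTorus_mem_chartTorusG L α S _)⟩ :
            ↥(Subgroup.centralizer ({s} : Set ↥(arch (↥(maximalRealSubfield L)) L (IsCMField.complexConj L) 3 (Matrix.diagonal α)))))
          ((chartTorusG L α S).subgroupOf (Subgroup.centralizer ({s} : Set ↥(arch (↥(maximalRealSubfield L)) L (IsCMField.complexConj L) 3 (Matrix.diagonal α)))))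
          (fun t ht => Subtype.ext (forall_mem_chartTorusG_comm L α S (p + ν • hcNrm w 0 2)
            (t : ↥(arch (↥(maximalRealSubfield L)) L (IsCMField.complexConj L) 3 (Matrix.diagonal α))) (Subgroup.mem_subgroupOf.1 ht)))
          aM kq ∂μ) :
    ∀ᶠ ν in 𝓝[≠] (0 : ℝ), chartOrbG L α ν' S a' (p + ν • hcNrm w 0 2) = (C₀ * ((κ : ℝ) : ℂ)) * ∫ b, aM (eM.symm (b * γB ν * b⁻¹, r₀)) ∂νB := by
  filter_upwards [hdescent] with ν hν
  rw [hν, integral_descConj_eq_smul_integral_of_block _ A eM Ψ hΨ μ νB hmap _ (γB ν) r₀ (hγ ν) _ haM, NNReal.smul_def, Complex.real_smul, mul_assoc]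

/-- **★ D4b ED. 2 ALONG THE NORMAL** (the eventual descent identity): with ONE cut-off `β ≥ 0` of unit `Z(s)`-mass on `C″ · Z(s)`, if for small `ν ≠ 0` the conjugates of
`gprimeTorus c_ν` meeting `tsupport a′` lie in `C″ · Z(s)` (`hCMν`, ★ D4b-1 on the compact normal segment) and the chart integrand at `c_ν` is integrable (`hintν`, regular points), then
for small `ν ≠ 0`: `chartOrbG L α ν′ S a′ c_ν = dt′(B′) · ∫_{Z(s) ⧸ T′} (a′)_M^β(k · gprimeTorus c_ν · k⁻¹) d(νM ∕ νT′)`, `(a′)_M^β(m) = ∫ β(x) • a′(x m x⁻¹) dν′`.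
[cite: Rogawski1990, §4.12 Lemma 4.12.1 p. 66; §8.2 p. 114] [cite: HarishChandra1970, Part I §3 Lemmas 22–23] [cite: Folland1995, §2.6 Thm. 2.49] -/
theorem chartOrbG_add_smul_hcNrm_eventuallyEq_descended_of_cutoff
    [LocallyCompactSpace ↥(Subgroup.centralizer ({s} : Set ↥(arch (↥(maximalRealSubfield L)) L (IsCMField.complexConj L) 3 (Matrix.diagonal α))))]
    (νM : Measure ↥(Subgroup.centralizer ({s} : Set ↥(arch (↥(maximalRealSubfield L)) L (IsCMField.complexConj L) 3 (Matrix.diagonal α)))))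
    [νM.IsHaarMeasure] [νM.IsMulRightInvariant] [νM.IsInvInvariant] (ha'c : Continuous a')
    {C'' : Set ↥(arch (↥(maximalRealSubfield L)) L (IsCMField.complexConj L) 3 (Matrix.diagonal α))}
    {β : ↥(arch (↥(maximalRealSubfield L)) L (IsCMField.complexConj L) 3 (Matrix.diagonal α)) → ℝ} (hβc : Continuous β) (hβs : HasCompactSupport β) (hβ0 : ∀ g, 0 ≤ β g)
    (hβ1 : ∀ x ∈ C'', ∀ k₀ : ↥(Subgroup.centralizer ({s} : Set ↥(arch (↥(maximalRealSubfield L)) L (IsCMField.complexConj L) 3 (Matrix.diagonal α)))),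
      ∫ h : ↥(Subgroup.centralizer ({s} : Set ↥(arch (↥(maximalRealSubfield L)) L (IsCMField.complexConj L) 3 (Matrix.diagonal α)))),
        β (x * (k₀ : ↥(arch (↥(maximalRealSubfield L)) L (IsCMField.complexConj L) 3 (Matrix.diagonal α))) *
          (h : ↥(arch (↥(maximalRealSubfield L)) L (IsCMField.complexConj L) 3 (Matrix.diagonal α)))) ∂νM = 1)
    (hCMν : ∀ᶠ ν in 𝓝[≠] (0 : ℝ), ∀ y' : ↥(arch (↥(maximalRealSubfield L)) L (IsCMField.complexConj L) 3 (Matrix.diagonal α)),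
      y' * gprimeTorus L α S (p + ν • hcNrm w 0 2) * y'⁻¹ ∈ tsupport a' →
        y' ∈ C'' * ((Subgroup.centralizer ({s} : Set ↥(arch (↥(maximalRealSubfield L)) L (IsCMField.complexConj L) 3 (Matrix.diagonal α)))) :
          Set ↥(arch (↥(maximalRealSubfield L)) L (IsCMField.complexConj L) 3 (Matrix.diagonal α))))
    (hintν : ∀ᶠ ν in 𝓝[≠] (0 : ℝ), Integrable (descConj (gprimeTorus L α S (p + ν • hcNrm w 0 2)) (chartTorusG L α S) (forall_mem_chartTorusG_comm L α S _) a')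
      (chartQuotientMeasureG L α ν' S)) :
    ∀ᶠ ν in 𝓝[≠] (0 : ℝ), chartOrbG L α ν' S a' (p + ν • hcNrm w 0 2) =
      (haveI := isHaarMeasure_chartHaarG L α S
       haveI := isInvInvariant_chartHaarG L α S
       haveI := isHaarMeasure_map_subgroupOfEquivOfLe_symm hT (chartHaarG L α S)
       haveI := isInvInvariant_map_subgroupOfEquivOfLe_symm hT (chartHaarG L α S)
      ((chartHaarG L α S (chartBoxImgG L α S)).toReal : ℂ) *
        ∫ kq, descConj
            (⟨gprimeTorus L α S (p + ν • hcNrm w 0 2), hT (gprimeTorus_mem_chartTorusG L α S _)⟩ :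
              ↥(Subgroup.centralizer ({s} : Set ↥(arch (↥(maximalRealSubfield L)) L (IsCMField.complexConj L) 3 (Matrix.diagonal α)))))
            ((chartTorusG L α S).subgroupOf (Subgroup.centralizer ({s} : Set ↥(arch (↥(maximalRealSubfield L)) L (IsCMField.complexConj L) 3 (Matrix.diagonal α)))))
            (fun t ht => Subtype.ext (forall_mem_chartTorusG_comm L α S (p + ν • hcNrm w 0 2)
              (t : ↥(arch (↥(maximalRealSubfield L)) L (IsCMField.complexConj L) 3 (Matrix.diagonal α))) (Subgroup.mem_subgroupOf.1 ht)))
            (fun m : ↥(Subgroup.centralizer ({s} : Set ↥(arch (↥(maximalRealSubfield L)) L (IsCMField.complexConj L) 3 (Matrix.diagonal α)))) =>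
              ∫ x, β x • a' (x * (m : ↥(arch (↥(maximalRealSubfield L)) L (IsCMField.complexConj L) 3 (Matrix.diagonal α))) * x⁻¹) ∂ν') kq
          ∂(quotientMeasure ((chartTorusG L α S).subgroupOf (Subgroup.centralizer ({s} : Set ↥(arch (↥(maximalRealSubfield L)) L (IsCMField.complexConj L) 3 (Matrix.diagonal α)))))
              (Measure.map (Subgroup.subgroupOfEquivOfLe hT).symm (chartHaarG L α S))
              (isClosed_subgroupOf_of_isClosed _ _ (isClosed_chartTorusG L α S)) νM)) := by
  filter_upwards [hCMν, hintν] with ν hCM hint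
  exact chartOrbG_eq_integral_descended_of_cutoff L α ν' S a' ha'c s νM hT hβc hβs hβ0 hβ1 (p + ν • hcNrm w 0 2) hint hCM

include hΨ hγ in
/-- **(J-G′-BLOCK) — THE PACKAGE FOR THE (J-G′-JUMP) SHELL.**  Under ★ D4b's data at the wall point `s` (cut-off `β`, Haar `νM` on `Z(s)`), the eventual binders `hCMν` ∕ `hintν`
along the normal, and the block data `(eM, Ψ, hΨ, νB, κ, hmap, γ_B, r₀, hγ)` of (M-UNFOLD): there is ONE test function `f_B ∈ C_c(B)` on the block — namely
`f_B(b) = (a′)_M^β(eM⁻¹(b, r₀))` — with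
**`∀ᶠ ν in 𝓝[≠] 0, chartOrbG L α ν′ S a′ (p + ν • hcNrm w 0 2) = (dt′(B′) · κ) · ∫_B f_B(b · γ_B(ν) · b⁻¹) dνB`**,
i.e. the (DESC) hypothesis `hdesc` of ★ `hasOneSidedJump_hcTwistedDeriv_orbFamGExt_of_bricks` with `K := dt′(B′)·κ` and `Φ ν := ∫_B f_B(b γ_B(ν) b⁻¹) dνB` — `Φ` in the currency of ★
`exists_hasOneSidedJump_two_sin_mul_orbitalIntegral_group_of_eq_over` (`F := f_B`). [cite: Rogawski1990, §4.12 Lemma 4.12.1 p. 66; §8.2 pp. 119–124]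
[cite: HarishChandra1970, Part I §3 Lemmas 22–23] [cite: Folland1995, §2.6 Thm. 2.49, (2.52)] [cite: Shelstad1979, §4 pp. 22–25] -/
theorem exists_block_testFunction_chartOrbG_eventuallyEq
    [LocallyCompactSpace ↥(Subgroup.centralizer ({s} : Set ↥(arch (↥(maximalRealSubfield L)) L (IsCMField.complexConj L) 3 (Matrix.diagonal α))))]
    (νM : Measure ↥(Subgroup.centralizer ({s} : Set ↥(arch (↥(maximalRealSubfield L)) L (IsCMField.complexConj L) 3 (Matrix.diagonal α)))))
    [νM.IsHaarMeasure] [νM.IsMulRightInvariant] [νM.IsInvInvariant] (ha'c : Continuous a') (ha's : HasCompactSupport a')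
    {C'' : Set ↥(arch (↥(maximalRealSubfield L)) L (IsCMField.complexConj L) 3 (Matrix.diagonal α))}
    {β : ↥(arch (↥(maximalRealSubfield L)) L (IsCMField.complexConj L) 3 (Matrix.diagonal α)) → ℝ} (hβc : Continuous β) (hβs : HasCompactSupport β) (hβ0 : ∀ g, 0 ≤ β g)
    (hβ1 : ∀ x ∈ C'', ∀ k₀ : ↥(Subgroup.centralizer ({s} : Set ↥(arch (↥(maximalRealSubfield L)) L (IsCMField.complexConj L) 3 (Matrix.diagonal α)))),
      ∫ h : ↥(Subgroup.centralizer ({s} : Set ↥(arch (↥(maximalRealSubfield L)) L (IsCMField.complexConj L) 3 (Matrix.diagonal α)))),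
        β (x * (k₀ : ↥(arch (↥(maximalRealSubfield L)) L (IsCMField.complexConj L) 3 (Matrix.diagonal α))) *
          (h : ↥(arch (↥(maximalRealSubfield L)) L (IsCMField.complexConj L) 3 (Matrix.diagonal α)))) ∂νM = 1)
    (hCMν : ∀ᶠ ν in 𝓝[≠] (0 : ℝ), ∀ y' : ↥(arch (↥(maximalRealSubfield L)) L (IsCMField.complexConj L) 3 (Matrix.diagonal α)),
      y' * gprimeTorus L α S (p + ν • hcNrm w 0 2) * y'⁻¹ ∈ tsupport a' →
        y' ∈ C'' * ((Subgroup.centralizer ({s} : Set ↥(arch (↥(maximalRealSubfield L)) L (IsCMField.complexConj L) 3 (Matrix.diagonal α)))) :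
          Set ↥(arch (↥(maximalRealSubfield L)) L (IsCMField.complexConj L) 3 (Matrix.diagonal α))))
    (hintν : ∀ᶠ ν in 𝓝[≠] (0 : ℝ), Integrable (descConj (gprimeTorus L α S (p + ν • hcNrm w 0 2)) (chartTorusG L α S) (forall_mem_chartTorusG_comm L α S _) a')
      (chartQuotientMeasureG L α ν' S))
    {κ : ℝ≥0}
    (hmap : (haveI := isHaarMeasure_chartHaarG L α S
       haveI := isInvInvariant_chartHaarG L α S
       haveI := isHaarMeasure_map_subgroupOfEquivOfLe_symm hT (chartHaarG L α S)
       haveI := isInvInvariant_map_subgroupOfEquivOfLe_symm hT (chartHaarG L α S)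
      Measure.map Ψ (quotientMeasure ((chartTorusG L α S).subgroupOf (Subgroup.centralizer ({s} : Set ↥(arch (↥(maximalRealSubfield L)) L (IsCMField.complexConj L) 3 (Matrix.diagonal α)))))
          (Measure.map (Subgroup.subgroupOfEquivOfLe hT).symm (chartHaarG L α S))
          (isClosed_subgroupOf_of_isClosed _ _ (isClosed_chartTorusG L α S)) νM)) = κ • Measure.map (QuotientGroup.mk : B → B ⧸ A) νB) :
    ∃ fB : B → ℂ, Continuous fB ∧ HasCompactSupport fB ∧
      (fB = fun b => (fun m : ↥(Subgroup.centralizer ({s} : Set ↥(arch (↥(maximalRealSubfield L)) L (IsCMField.complexConj L) 3 (Matrix.diagonal α)))) =>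
        ∫ x, β x • a' (x * (m : ↥(arch (↥(maximalRealSubfield L)) L (IsCMField.complexConj L) 3 (Matrix.diagonal α))) * x⁻¹) ∂ν') (eM.symm (b, r₀))) ∧
      ∀ᶠ ν in 𝓝[≠] (0 : ℝ), chartOrbG L α ν' S a' (p + ν • hcNrm w 0 2) =
        ((((haveI := isHaarMeasure_chartHaarG L α S; chartHaarG L α S (chartBoxImgG L α S))).toReal : ℂ) * ((κ : ℝ) : ℂ)) * ∫ b, fB (b * γB ν * b⁻¹) ∂νB := by
  have hM' : IsClosed ((Subgroup.centralizer ({s} : Set ↥(arch (↥(maximalRealSubfield L)) L (IsCMField.complexConj L) 3 (Matrix.diagonal α)))) :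
      Set ↥(arch (↥(maximalRealSubfield L)) L (IsCMField.complexConj L) 3 (Matrix.diagonal α))) := isClosed_centralizer_singleton_of_t2 _
  -- the descended function `(a′)_M^β` is in `C_c(Z(s))`
  have haMc : Continuous fun m : ↥(Subgroup.centralizer ({s} : Set ↥(arch (↥(maximalRealSubfield L)) L (IsCMField.complexConj L) 3 (Matrix.diagonal α)))) =>
      ∫ x, β x • a' (x * (m : ↥(arch (↥(maximalRealSubfield L)) L (IsCMField.complexConj L) 3 (Matrix.diagonal α))) * x⁻¹) ∂ν' :=
    continuous_integral_conj_subtype ν' _ hβc hβs ha'c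
  have haMs : HasCompactSupport fun m : ↥(Subgroup.centralizer ({s} : Set ↥(arch (↥(maximalRealSubfield L)) L (IsCMField.complexConj L) 3 (Matrix.diagonal α)))) =>
      ∫ x, β x • a' (x * (m : ↥(arch (↥(maximalRealSubfield L)) L (IsCMField.complexConj L) 3 (Matrix.diagonal α))) * x⁻¹) ∂ν' :=
    hasCompactSupport_integral_conj ν' _ hM' hβs ha's
  refine ⟨_, continuous_comp_symm_prodMk eM haMc r₀, hasCompactSupport_comp_symm_prodMk eM haMs r₀, rfl, ?_⟩
  have hdescent := chartOrbG_add_smul_hcNrm_eventuallyEq_descended_of_cutoff L α ν' a' S w p s hT νM ha'c hβc hβs hβ0 hβ1 hCMν hintν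
  exact chartOrbG_add_smul_hcNrm_eventuallyEq_of_block L α ν' a' S w p s hT A eM Ψ hΨ νB γB r₀ hγ _ hmap haMc hdescent

end Chart

end Literature.NumberTheory.Rogawski1990

end
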